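import Mathlib.Computability.Language
import Literature.Computability.Complexity.BoolEncodings
import Literature.Computability.Complexity.Classes
import Literature.Computability.Complexity.Nondeterministic
import Literature.Computability.Complexity.Reductions
import Literature.Computability.Complexity.ProbabilisticClasses
import HarnessLib

-- provenance: harness21/H21/H21/Prelude/CplxCore/Promise.lean @ ca67219 (interim HEAD d8f2665); M5 mechanical rewrite
/-!
# Complexity core: promise problems

Trunk `CplxCore`, outline item C12 (notion `promise_problem`).

A *promise problem* over `{0,1}` is a pair `(Π_yes, Π_no)` of languages (intended to be
disjoint); an algorithm "solves" it if it accepts every yes-instance and rejects every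
no-instance, with no requirement outside the promise `Π_yes ∪ Π_no`
[Even–Selman–Yacobi 1984; Goldreich, *On promise problems: a survey*, 2006, Def. 1.1;
Micciancio–Goldwasser 2002, Ch. 1, §1.2 (GapSVP)].

## Contents

* `PromiseProblem` (fields `yes no : Language Bool`), `PromiseProblem.Disjoint`,
  `PromiseProblem.ofLanguage L = ⟨L, Lᶜ⟩`, `PromiseProblem.swap`,
  `PromiseProblem.ofEncoding e Y N = ⟨e.toLanguage Y, e.toLanguage N⟩`.
* `promiseLift C`: the promise problems separated by some language of the class `C`;
  `PromiseP`, `PromiseNP`, `PromiseCoNP`, `PromiseBPP` are `promiseLift` of `P`, `NP`, `coNP`,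
  `BPP`.  Also `PromiseBPP'`, the genuine textbook promise-BPP (gap only on the promise).
* `PromiseProblem.PolyTimeReducible`, `PromiseProblem.IsHard`, `PromiseProblem.IsNPHard`.
* API: `ofLanguage_mem_promiseLift_iff`, `polyTimeReducible_ofLanguage_iff`,
  `PromiseProblem.PolyTimeReducible.trans` (sorry: needs composition in `FP`),
  `PromiseProblem.IsHard.of_reducible` (from `trans`), closure of `PromiseP`/`PromiseNP` under
  reductions (sorry).

## Design choices

* (Outline D3, promise rule.) `promiseLift C` means "some language `L ∈ C` separates `yes`
  from `no`" (`yes ≤ L`, `no ≤ Lᶜ`).  For syntactic classes (`P`, `NP`, `coNP`) this is the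
  textbook promise class.  For the semantic class `BPP` it is *stronger* than textbook
  promise-BPP, which asks for the `2/3` gap only on the promise: `PromiseBPP := promiseLift BPP`
  requires a machine with a BPP-gap on *all* inputs.  No target statement needs the weaker
  class; it is nevertheless recorded as `PromiseBPP'`, defined directly with `uniformProb`
  (and `PromiseBPP ⊆ PromiseBPP'` is stated).
* Reductions between promise problems are Karp-style maps in `FP` sending yes to yes and no
  to no [Goldreich 2006, Def. 1.4]; on `ofLanguage` they coincide with
  `PolyTimeKarpReducible` (`polyTimeReducible_ofLanguage_iff`).
* `Π` is a Lean keyword, so promise problems are named `Q`, `Q₁`, … in binders.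
* Mathlib has no promise problems (searched `Promise`, `PromiseProblem`); nothing is
  duplicated.  Universe convention `α : Type` (outline D7).
-/

namespace Literature.Computability.Complexity

open _root_.Computability

variable {α : Type}

/-! ### Promise problems -/

/-- A promise problem over the alphabet `{0,1}`: a set `yes` of yes-instances and a set `no`
of no-instances (languages over `Bool`).  The *promise* is `yes ⊔ no`; the two parts are
intended to be disjoint (`PromiseProblem.Disjoint`), but this is not part of the data.
[Even–Selman–Yacobi 1984, §2; Goldreich 2006, Def. 1.1] [cite: EvenSelmanYacobi1984, §2] -/
structure PromiseProblem where
  /-- The yes-instances. -/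
  yes : Language Bool
  /-- The no-instances. -/
  no : Language Bool

namespace PromiseProblem

/-- A promise problem is *disjoint* if no string is both a yes- and a no-instance
(`Q.yes ⊓ Q.no = ⊥`, via Mathlib's lattice `Disjoint`). [Goldreich 2006, Def. 1.1] [cite: Goldreich2006, Def. 1.1] -/
protected def Disjoint (Q : PromiseProblem) : Prop :=
  _root_.Disjoint Q.yes Q.no

/-- The promise problem of a language `L`: yes-instances `L`, no-instances `Lᶜ` (trivial
promise). [Goldreich 2006, §1.1 (languages as promise problems with trivial promise)] [cite: Goldreich2006, §1.1 (languages as promise problems with] -/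
def ofLanguage (L : Language Bool) : PromiseProblem :=
  ⟨L, Lᶜ⟩

/-- The complementary promise problem: swap yes- and no-instances.
[Goldreich 2006, §1.1 and Def. 5.1 (promise-co𝒞)] [cite: Goldreich2006, §1.1 and Def. 5.1 (promise-co𝒞] -/
def swap (Q : PromiseProblem) : PromiseProblem :=
  ⟨Q.no, Q.yes⟩

/-- The promise problem over `{0,1}` obtained from sets `Y N : Set α` of mathematical objects
via a Boolean encoding `e : Encoding α Bool`: yes-instances `e.toLanguage Y = e.encode '' Y`,
no-instances `e.toLanguage N`.  E.g. `GapSVP_γ` from the sets of (basis, radius) pairs with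
`λ₁ ≤ r` resp. `λ₁ > γ r`. [Micciancio–Goldwasser 2002, Ch. 1, §1.2; Goldreich 2006, §1.1] [cite: MicciancioGoldwasser2002, Ch. 1  §1.2] -/
def ofEncoding (e : Encoding α Bool) (Y N : Set α) : PromiseProblem :=
  ⟨e.toLanguage Y, e.toLanguage N⟩

/-- The yes-instances of `ofLanguage L` are `L`. [Goldreich 2006, §1.1] [cite: Goldreich2006, §1.1] -/
@[simp] theorem yes_ofLanguage (L : Language Bool) : (ofLanguage L).yes = L := rfl

/-- The no-instances of `ofLanguage L` are `Lᶜ`. [Goldreich 2006, §1.1] [cite: Goldreich2006, §1.1] -/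
@[simp] theorem no_ofLanguage (L : Language Bool) : (ofLanguage L).no = Lᶜ := rfl

/-- The yes-instances of `Q.swap` are the no-instances of `Q`. [Goldreich 2006, §1.1] [cite: Goldreich2006, §1.1] -/
@[simp] theorem yes_swap (Q : PromiseProblem) : Q.swap.yes = Q.no := rfl

/-- The no-instances of `Q.swap` are the yes-instances of `Q`. [Goldreich 2006, §1.1] [cite: Goldreich2006, §1.1] -/
@[simp] theorem no_swap (Q : PromiseProblem) : Q.swap.no = Q.yes := rfl

/-- The yes-instances of `ofEncoding e Y N` are the encodings of `Y`.
[Micciancio–Goldwasser 2002, Ch. 1, §1.2] [cite: MicciancioGoldwasser2002, Ch. 1  §1.2] -/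
@[simp] theorem yes_ofEncoding (e : Encoding α Bool) (Y N : Set α) :
    (ofEncoding e Y N).yes = e.toLanguage Y := rfl

/-- The no-instances of `ofEncoding e Y N` are the encodings of `N`.
[Micciancio–Goldwasser 2002, Ch. 1, §1.2] [cite: MicciancioGoldwasser2002, Ch. 1  §1.2] -/
@[simp] theorem no_ofEncoding (e : Encoding α Bool) (Y N : Set α) :
    (ofEncoding e Y N).no = e.toLanguage N := rfl

/-- `swap` is an involution. [Goldreich 2006, §1.1] [cite: Goldreich2006, §1.1] -/
@[simp] theorem swap_swap (Q : PromiseProblem) : Q.swap.swap = Q := rfl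

/-- Swapping the promise problem of `L` gives the promise problem of `Lᶜ`.
[Goldreich 2006, §1.1] [cite: Goldreich2006, §1.1] -/
@[simp] theorem swap_ofLanguage (L : Language Bool) : (ofLanguage L).swap = ofLanguage Lᶜ := by
  simp [swap, ofLanguage]

/-- Swapping `ofEncoding e Y N` gives `ofEncoding e N Y`. [Goldreich 2006, §1.1] [cite: Goldreich2006, §1.1] -/
@[simp] theorem swap_ofEncoding (e : Encoding α Bool) (Y N : Set α) :
    (ofEncoding e Y N).swap = ofEncoding e N Y := rfl

/-- The promise problem of a language is disjoint. [Goldreich 2006, §1.1] [cite: Goldreich2006, §1.1] -/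
theorem disjoint_ofLanguage (L : Language Bool) : (ofLanguage L).Disjoint :=
  disjoint_compl_right

/-- Disjointness is preserved by `swap`. [Goldreich 2006, §1.1] [cite: Goldreich2006, §1.1] -/
theorem Disjoint.swap {Q : PromiseProblem} (h : Q.Disjoint) : Q.swap.Disjoint :=
  _root_.Disjoint.symm h

/-- `ofEncoding e Y N` is disjoint as soon as `Y` and `N` are (encodings are injective).
[Micciancio–Goldwasser 2002, Ch. 1, §1.2] [cite: MicciancioGoldwasser2002, Ch. 1  §1.2] -/
theorem disjoint_ofEncoding (e : Encoding α Bool) {Y N : Set α} (h : _root_.Disjoint Y N) :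
    (ofEncoding e Y N).Disjoint := by
  change _root_.Disjoint (e.encode '' Y) (e.encode '' N)
  exact (Set.disjoint_image_iff e.encode_injective).2 h

end PromiseProblem

/-! ### Promise classes -/

/-- The promise lift of a class of languages: `Q ∈ promiseLift C` iff some language `L ∈ C`
*separates* `Q`, i.e. `Q.yes ≤ L` and `Q.no ≤ Lᶜ` (every yes-instance is in `L`, no
no-instance is).  For syntactically defined classes this is the textbook promise class
`promise-C`; for semantic classes such as `BPP` it is stronger (see `PromiseBPP`, outline D3).
[Goldreich 2006, §1.1 and Def. 1.2; Even–Selman–Yacobi 1984, §2] [cite: Goldreich2006, §1.1 and Def. 1.2] -/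
def promiseLift (C : Set (Language Bool)) : Set PromiseProblem :=
  {Q | ∃ L ∈ C, Q.yes ≤ L ∧ Q.no ≤ Lᶜ}

/-- `PromiseP = promiseLift P`: promise problems solvable in deterministic polynomial time
(some `L ∈ P` contains all yes-instances and no no-instance). [Goldreich 2006, Def. 1.2] [cite: Goldreich2006, Def. 1.2] -/
noncomputable def PromiseP : Set PromiseProblem :=
  promiseLift Classes.P

/-- `PromiseNP = promiseLift NP`: promise problems with an NP language separating yes from no.
[Goldreich 2006, Def. 1.3 (search/decision promise-NP)] [cite: Goldreich2006, Def. 1.3 (search/decision promise-NP] -/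
noncomputable def PromiseNP : Set PromiseProblem :=
  promiseLift Nondeterministic.NP

/-- `PromiseCoNP = promiseLift coNP`: promise problems with a coNP language separating yes
from no. [Goldreich 2006, §5.1] [cite: Goldreich2006, §5.1] -/
noncomputable def PromiseCoNP : Set PromiseProblem :=
  promiseLift coNP

/-- `PromiseBPP = promiseLift BPP`: promise problems separated by some `BPP` language.
**Caveat (outline D3).** This is *stronger* than the textbook class promise-BPP, in which the
probabilistic machine is only required to have a `2/3` acceptance gap on inputs satisfying the
promise (and may behave arbitrarily elsewhere); the textbook class is `PromiseBPP'`.  No H21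
target statement needs the weaker class. [Goldreich 2006, Def. 1.2 and §1.2 (discussion of
BPP as a promise class)] [cite: Goldreich2006, Def. 1.2 and §1.2 (discussion of BPP as] -/
noncomputable def PromiseBPP : Set PromiseProblem :=
  promiseLift BPP

/-- `PromiseBPP'`: the textbook class promise-BPP.  `Q ∈ PromiseBPP'` iff there are `L' ∈ P`
and a polynomial `p` such that on every yes-instance `x` at least `2/3` of the coin strings
`y` of length `p |x|` have `boolPair x y ∈ L'`, and on every no-instance at least `2/3` have
`boolPair x y ∉ L'`; nothing is required off the promise (contrast `PromiseBPP`).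
[Goldreich 2006, Def. 1.2 (promise-BPP); Arora–Barak 2009, Def. 7.3] [cite: Goldreich2006, Def. 1.2 (promise-BPP] -/
noncomputable def PromiseBPP' : Set PromiseProblem :=
  {Q | ∃ L' ∈ Classes.P, ∃ p : Polynomial ℕ,
    (∀ x ∈ Q.yes, 2 / 3 ≤ uniformProb (p.eval x.length) {y : List Bool | boolPair x y ∈ L'}) ∧
    (∀ x ∈ Q.no, 2 / 3 ≤ uniformProb (p.eval x.length) {y : List Bool | boolPair x y ∉ L'})}

/-- Unfolding lemma for `promiseLift`. [Goldreich 2006, Def. 1.2] [cite: Goldreich2006, Def. 1.2] -/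
theorem mem_promiseLift_iff {C : Set (Language Bool)} {Q : PromiseProblem} :
    Q ∈ promiseLift C ↔ ∃ L ∈ C, Q.yes ≤ L ∧ Q.no ≤ Lᶜ :=
  Iff.rfl

/-- `promiseLift` is monotone in the class. [Goldreich 2006, §1.1] [cite: Goldreich2006, §1.1] -/
theorem promiseLift_mono {C D : Set (Language Bool)} (h : C ⊆ D) : promiseLift C ⊆ promiseLift D :=
  fun _ ⟨L, hL, hy, hn⟩ => ⟨L, h hL, hy, hn⟩

/-- A language, viewed as a promise problem with trivial promise, lies in `promiseLift C` iff
it lies in `C` (the only separating language of `⟨L, Lᶜ⟩` is `L` itself).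
[Goldreich 2006, §1.1] [cite: Goldreich2006, §1.1] -/
@[simp] theorem ofLanguage_mem_promiseLift_iff {C : Set (Language Bool)} {L : Language Bool} :
    PromiseProblem.ofLanguage L ∈ promiseLift C ↔ L ∈ C := by
  constructor
  · rintro ⟨L', hL', hy, hn⟩
    have : L = L' := le_antisymm hy (compl_le_compl_iff_le.1 hn)
    exact this ▸ hL'
  · intro hL
    exact ⟨L, hL, le_rfl, le_rfl⟩

/-- Members of `promiseLift C` are disjoint promise problems (a separating language witnesses
disjointness). [Goldreich 2006, Def. 1.1] [cite: Goldreich2006, Def. 1.1] -/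
theorem PromiseProblem.Disjoint.of_mem_promiseLift {C : Set (Language Bool)} {Q : PromiseProblem}
    (h : Q ∈ promiseLift C) : Q.Disjoint := by
  obtain ⟨L, -, hy, hn⟩ := h
  exact Disjoint.mono hy hn disjoint_compl_right

/-- `swap` exchanges `promiseLift C` and `promiseLift (co C)`. [Goldreich 2006, §5.1] [cite: Goldreich2006, §5.1] -/
theorem swap_mem_promiseLift_iff {C : Set (Language Bool)} {Q : PromiseProblem} :
    Q.swap ∈ promiseLift C ↔ Q ∈ promiseLift (co C) := by
  constructor
  · rintro ⟨L, hL, hy, hn⟩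
    refine ⟨Lᶜ, ?_, ?_, ?_⟩
    · simpa [co] using hL
    · exact hn
    · simpa using hy
  · rintro ⟨L, hL, hy, hn⟩
    exact ⟨Lᶜ, hL, hn, by simpa using hy⟩

/-- The strong promise-BPP is contained in the textbook one: a BPP-gap on all inputs gives a
gap on the promise. [Goldreich 2006, §1.2] [cite: Goldreich2006, §1.2] -/
def PromiseBPP_subset_PromiseBPP' : Prop :=
  PromiseBPP ⊆ PromiseBPP'

/-! ### Reductions and hardness for promise problems -/

namespace PromiseProblem

open scoped Notation

/-- Polynomial-time (Karp) reducibility of promise problems: `Q₁.PolyTimeReducible Q₂` iff some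
`f ∈ FP` maps yes-instances of `Q₁` to yes-instances of `Q₂` and no-instances to no-instances.
[Goldreich 2006, Def. 1.4 (Karp reductions among promise problems); Even–Selman–Yacobi 1984,
§2] [cite: Goldreich2006, Def. 1.4 (Karp reductions among promise] -/
def PolyTimeReducible (Q₁ Q₂ : PromiseProblem) : Prop :=
  ∃ f ∈ FP, Set.MapsTo f Q₁.yes Q₂.yes ∧ Set.MapsTo f Q₁.no Q₂.no

/-- `IsHard C Q`: the promise problem `Q` is `C`-hard, i.e. every language `L ∈ C` (as the
promise problem `ofLanguage L`) polynomial-time reduces to `Q`.  E.g. NP-hardness of `GapSVP`.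
[Goldreich 2006, §1.1 and Def. 1.4; Micciancio–Goldwasser 2002, Ch. 1, §1.2] [cite: Goldreich2006, §1.1 and Def. 1.4] -/
def IsHard (C : Set (Language Bool)) (Q : PromiseProblem) : Prop :=
  ∀ L ∈ C, (ofLanguage L).PolyTimeReducible Q

/-- `IsNPHard Q`: the promise problem `Q` is NP-hard (`IsHard NP Q`).
[Goldreich 2006, §1.1; Micciancio–Goldwasser 2002, Ch. 1, §1.2] [cite: Goldreich2006, §1.1] -/
abbrev IsNPHard (Q : PromiseProblem) : Prop :=
  IsHard Nondeterministic.NP Q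

/-- Unfolding lemma for `PromiseProblem.PolyTimeReducible`. [Goldreich 2006, Def. 1.4] [cite: Goldreich2006, Def. 1.4] -/
theorem polyTimeReducible_iff {Q₁ Q₂ : PromiseProblem} :
    Q₁.PolyTimeReducible Q₂ ↔
      ∃ f ∈ FP, Set.MapsTo f Q₁.yes Q₂.yes ∧ Set.MapsTo f Q₁.no Q₂.no :=
  Iff.rfl

/-- On languages (trivial promise), promise reducibility is exactly Karp reducibility:
`(ofLanguage L₁).PolyTimeReducible (ofLanguage L₂) ↔ L₁ ≤ₚ L₂`. [Goldreich 2006, §1.1] [cite: Goldreich2006, §1.1] -/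
theorem polyTimeReducible_ofLanguage_iff {L₁ L₂ : Language Bool} :
    (ofLanguage L₁).PolyTimeReducible (ofLanguage L₂) ↔ PolyTimeKarpReducible L₁ L₂ := by
  rw [polyTimeKarpReducible_iff]
  constructor
  · rintro ⟨f, hf, hy, hn⟩
    refine ⟨f, hf, fun x => ⟨fun hx => hy hx, fun hx => ?_⟩⟩
    by_contra hx'
    exact hn hx' hx
  · rintro ⟨f, hf, h⟩
    exact ⟨f, hf, fun x hx => (h x).1 hx, fun x hx hfx => hx ((h x).2 hfx)⟩

/-- Promise reducibility is reflexive (identity in `FP`). [Goldreich 2006, Def. 1.4] [cite: Goldreich2006, Def. 1.4] -/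
protected theorem PolyTimeReducible.refl (Q : PromiseProblem) : Q.PolyTimeReducible Q :=
  ⟨id, PolyTimeComputable.id id, Set.mapsTo_id _, Set.mapsTo_id _⟩

/-- Promise reducibility is transitive (composition in `FP`, cf. `PolyTimeComputable.comp`,
a Mathlib `proof_wanted`). [Goldreich 2006, Def. 1.4] [cite: Goldreich2006, Def. 1.4] -/
def PolyTimeReducible.trans : Prop :=
  ∀ {Q₁ Q₂ Q₃ : PromiseProblem} (h₁₂ : Q₁.PolyTimeReducible Q₂) (h₂₃ : Q₂.PolyTimeReducible Q₃),
    Q₁.PolyTimeReducible Q₃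

/-- A promise reduction restricts to swapped problems unchanged.
[Goldreich 2006, Def. 1.4] [cite: Goldreich2006, Def. 1.4] -/
theorem PolyTimeReducible.swap {Q₁ Q₂ : PromiseProblem} (h : Q₁.PolyTimeReducible Q₂) :
    Q₁.swap.PolyTimeReducible Q₂.swap := by
  obtain ⟨f, hf, hy, hn⟩ := h
  exact ⟨f, hf, hn, hy⟩

/-- `PromiseP` is closed downwards under promise reductions. [Goldreich 2006, §1.1] [cite: Goldreich2006, §1.1] -/
def mem_PromiseP_of_polyTimeReducible : Prop :=
  ∀ {Q₁ Q₂ : PromiseProblem} (h : Q₁.PolyTimeReducible Q₂) (h₂ : Q₂ ∈ PromiseP),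
    Q₁ ∈ PromiseP

/-- `PromiseNP` is closed downwards under promise reductions. [Goldreich 2006, §1.1] [cite: Goldreich2006, §1.1] -/
def mem_PromiseNP_of_polyTimeReducible : Prop :=
  ∀ {Q₁ Q₂ : PromiseProblem} (h : Q₁.PolyTimeReducible Q₂) (h₂ : Q₂ ∈ PromiseNP),
    Q₁ ∈ PromiseNP

/-- Hardness of a language `L` (Karp, `CplxCore.IsHard`) is hardness of the promise problem
`ofLanguage L`. [Goldreich 2006, §1.1] [cite: Goldreich2006, §1.1] -/
theorem isHard_ofLanguage_iff {C : Set (Language Bool)} {L : Language Bool} :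
    (ofLanguage L).IsHard C ↔ Complexity.IsHard C L := by
  simp only [IsHard, Complexity.IsHard, polyTimeReducible_ofLanguage_iff]

/-- Hardness propagates along promise reductions: if `Q` is `C`-hard and `Q` reduces to `Q'`
then `Q'` is `C`-hard (transitivity). [Goldreich 2006, §1.1 and Def. 1.4] [cite: Goldreich2006, §1.1 and Def. 1.4] -/
def IsHard.of_reducible : Prop :=
  ∀ {C : Set (Language Bool)} {Q Q' : PromiseProblem} (h : Q.IsHard C) (hQQ' : Q.PolyTimeReducible Q'),
    Q'.IsHard C

/- interim proof relied on results that are now named facts (D-0014); demoted to a fact by the M5 import, proof preserved: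
:=
  fun L hL => (h L hL).trans hQQ'
-/

/-- If an NP-hard promise problem is in `PromiseP` then `NP ⊆ P`.
[Goldreich 2006, §1.1; Micciancio–Goldwasser 2002, Ch. 1, §1.2] [cite: Goldreich2006, §1.1] -/
def NP_subset_P_of_isNPHard_of_mem_PromiseP : Prop :=
  ∀ {Q : PromiseProblem} (h : Q.IsNPHard) (hQ : Q ∈ PromiseP),
    Nondeterministic.NP ⊆ Classes.P

/- interim proof relied on results that are now named facts (D-0014); demoted to a fact by the M5 import, proof preserved:
:=
  fun L hL => ofLanguage_mem_promiseLift_iff.1 (mem_PromiseP_of_polyTimeReducible (h L hL) hQ)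
-/

end PromiseProblem

end Literature.Computability.Complexity
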